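import Literature.Computability.Cryptography.RegevReductionCVPqSplit
import Literature.Probability.Distributions.IndepProductLawDistance
import Literature.Probability.Distributions.UniformFibreApprox
import HarnessLib

/-!
# Regev 2009, §3.2.1 with APPROXIMATE samplers: stability of the batch-conditional experiment of
# Lemmas 3.6/3.7/3.11/4.1 under perturbation of the machine's three primitive laws

Topic `Computability/Cryptography` (family `pqc`), sequel of `RegevReductionCVPqSplit.lean` (the
batch-conditional experiment `Regev2009.condExpK` / `Regev2009.DigitOracle.condExp` that the residual
named fact A_cvpqM = `regev2009_lemma_3_11_cvpqMachine q α` asks a uniform quantum family to SIMULATE up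
to a negligible additive error). O. Regev, *On lattices, learning with errors, random linear codes, and
cryptography*, J. ACM 56 (2009), art. 34 (author's version arXiv:2401.03703). **Lemma 3.11** (p. 18,
proof, Eq. (10)): the reduction samples "`v ∈ L` from `D_{L,r}`" and outputs "`(a, ⟨x, v⟩/p + e mod 1)`"
with "`e`" Gaussian noise it draws itself; **Lemma 3.7** (p. 16, proof): it adds noise of its own choosing
("taking samples … from `A_{s,Ψ_β}` … and … `Ψ_γ`") and **Lemma 4.1** (p. 23, proof) shifts the secret by a
uniformly random `t`. A machine draws these three kinds of randomness from fair coins, hence only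
APPROXIMATELY (an integer Gaussian `⌊M·e⌋` has irrational point masses; a uniform element of `ℤ_q` is not
an exact image of finitely many fair coins unless `q` is a power of two). This file proves that the
experiment is STABLE under such approximation, which is the law-level half of what a proof of A_cvpqM
must supply (the other half being the programs themselves).

## What this file does (all PROVED; no named fact)

* `Regev2009.condBlockDataG` / `Regev2009.condExpG`: the conditional block data and the whole conditional
  experiment of `RegevReductionCVPqSplit.lean` with the three primitive laws as PARAMETERS — the shift
  law `U` on `ℤ_qⁿ`, the coarse integer-noise law `χc j` of block `j`, the fine integer-noise law `χf` —
  and `condExpG_gaussian : condExpG (uniform) (floorGaussian …) (floorGaussian …) = condExpK` (`rfl`).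
* `tvDist_condBlockDataG_le`, **`tvDist_condExpG_le`**: the hybrid argument —
  `Δ(condExpG U χc χf, condExpG U' χc' χf') ≤ Σ_j (Δ(U,U') + m·Δ(χc j, χc' j) + N_V·Δ(χf, χf'))`
  (kernel contraction for the oracle call and data processing for `firstAcceptedK`, so the bound holds
  for EVERY oracle kernel `A` and EVERY acceptance test).
* `PMF.toOuterMeasure_le_add_ofReal_tvDist` (event form of `Δ`) and **`simulates_condExpK_of_condExpG`**:
  if some law `T` dominates `condExpG U' χc' χf'` event-wise up to `ν` (the shape of A_cvpqM's
  inequality) and the primitive laws are `δ_U`, `δ_c`, `δ_f`-close to the ideal ones, then `T` dominates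
  `condExpK` up to `ν + (K_g+1)J(δ_U + m δ_c + N_V δ_f)`.
* `Regev2009.DigitOracle.condExpS`, `condExpS_gaussian` (`rfl`), **`simulates_condExp_of_condExpS`**: the same
  at the level of an instance (`DigitOracle.condExp` of `RegevReductionCVPqSplit.lean`, the object named in
  A_cvpqM), with the schedule's constants.
* `Regev2009.shiftLawBits` and **`tvDist_shiftLawBits_le`**: the machine's natural shift sampler — `n`
  independent blocks of `ℓ` fair coins read as integers `mod q` — is within `n·q/2^ℓ` of uniform on `ℤ_qⁿ`
  (`tvDist_map_natMod_uniform_le` coordinatewise + the hybrid bound), so `ℓ = size q + n` costs `≤ n/2ⁿ`.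

HONEST FRAMING: the value is a THEOREM (the perturbation bookkeeping of Regev's classical procedure,
kernel-checked, standard axioms) serving a future discharge of A_cvpqM — it is NOT progress on any summit
and breaks nothing; A_cvpqM itself is untouched by this file.

References: RegevLWE2009 (arXiv:2401.03703: Lemma 3.7 p. 16, Lemma 3.11 p. 18, Lemma 4.1 p. 23);
Goldreich2001 (Foundations of Cryptography I, §3.2: statistical distance, hybrid argument).
-/

noncomputable section

open Finset Module MeasureTheory Filter
open scoped ENNReal

/-! ### Event form of statistical distance -/

namespace PMF

/-- **Event form of `Δ`**: `p(S) ≤ q(S) + Δ(p, q)` in `ℝ≥0∞`. [cite: Goldreich2001, §3.2.1] -/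
theorem toOuterMeasure_le_add_ofReal_tvDist {β : Type*} (p q : PMF β) (S : Set β) :
    p.toOuterMeasure S ≤ q.toOuterMeasure S + ENNReal.ofReal (p.tvDist q) := by
  have h := PMF.toReal_toOuterMeasure_sub_le_tvDist p q S
  have hp : p.toOuterMeasure S ≠ ⊤ := Literature.Probability.Moments.pmf_toOuterMeasure_ne_top p S
  have hq : q.toOuterMeasure S ≠ ⊤ := Literature.Probability.Moments.pmf_toOuterMeasure_ne_top q S
  calc p.toOuterMeasure S = ENNReal.ofReal (p.toOuterMeasure S).toReal := (ENNReal.ofReal_toReal hp).symm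
    _ ≤ ENNReal.ofReal ((q.toOuterMeasure S).toReal + p.tvDist q) := ENNReal.ofReal_le_ofReal (by linarith)
    _ = ENNReal.ofReal (q.toOuterMeasure S).toReal + ENNReal.ofReal (p.tvDist q) :=
        ENNReal.ofReal_add ENNReal.toReal_nonneg (PMF.tvDist_nonneg _ _)
    _ = q.toOuterMeasure S + ENNReal.ofReal (p.tvDist q) := by rw [ENNReal.ofReal_toReal hq]

end PMF

namespace Literature.Computability.Cryptography

namespace Regev2009

open Literature.Probability.Distributions Literature.Probability.Moments LWE
  Literature.Algebra.EuclideanLattices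

/-! ### The conditional experiment with the primitive laws as parameters -/

section ConditionalG

variable {E : Type} [NormedAddCommGroup E] [InnerProductSpace ℝ E]
variable {L : Submodule ℤ E} {n : ℕ} (bL : Basis (Fin n) ℤ L) (q K : ℕ) [NeZero q] [NeZero K] (m NV Kg J : ℕ)

/-- LOCAL GLUE. **Coarse manufactured sample from one lattice vector with noise law `χ`**:
`v ↦ (L⁻¹v mod q, ⌊(num v + i + N/2)/N⌋ mod q)`, `i ← χ` (`χ = floorGaussian (qN) σ_j` ideally).
[cite: RegevLWE2009, Lemma 3.11 (proof, Eq. (10))] -/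
def coarseKerG (χ : PMF ℤ) (N : ℕ) (num : L → ℤ) (v : L) : PMF ((Fin n → ZMod q) × ZMod q) :=
  χ.map fun i : ℤ => (coeffMod bL q v, (((num v + i + (N / 2 : ℕ)) / (N : ℤ) : ℤ) : ZMod q))

/-- LOCAL GLUE. **Fine manufactured sample from one lattice vector with noise law `χ`** (modulus `qK`).
[cite: RegevLWE2009, Lemma 3.11 (proof, Eq. (10)) with Lemma 3.7 (proof)] -/
def fineKerG (χ : PMF ℤ) (N : ℕ) (num : L → ℤ) (v : L) : PMF ((Fin n → ZMod q) × ZMod (q * K)) :=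
  χ.map fun i : ℤ => (coeffMod bL q v, ((((K : ℤ) * num v + i + (N / 2 : ℕ)) / (N : ℤ) : ℤ) : ZMod (q * K)))

/-- LOCAL GLUE. **Block data GIVEN the block's `m + N_V` lattice vectors, with primitive laws `U`
(shift), `χc` (coarse noise), `χf` (fine noise)**. [cite: RegevLWE2009, Lemma 3.11 (proof) with Lemma 3.7 (proof)] -/
def condBlockDataG (U : PMF (Fin n → ZMod q)) (χc χf : PMF ℤ) (N : ℕ) (num : L → ℤ)
    (u : Fin (m + NV) → L) :
    PMF (((Fin n → ZMod q) × (Fin m → (Fin n → ZMod q) × ZMod q)) ×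
      (Fin NV → (Fin n → ZMod q) × ZMod (q * K))) :=
  prodLaw (prodLaw U (indepLaw m fun i => coarseKerG bL q χc N num (u (Fin.castAdd NV i))))
    (indepLaw NV fun i => fineKerG bL q K χf N num (u (Fin.natAdd m i)))

/-- LOCAL GLUE. **The whole experiment GIVEN the lattice batch, with primitive laws as parameters**:
per block the conditional data, the oracle call (`withAnswer`), then `firstAcceptedK`. A machine with
its own (approximate) samplers realises `condExpG` with ITS sampler laws in place of the ideal ones.
[cite: RegevLWE2009, Lemma 3.4 (proof = §3.2.1: Lemmas 3.7, 3.11)] -/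
def condExpG (U : PMF (Fin n → ZMod q)) (χc : Fin ((Kg + 1) * J) → PMF ℤ) (χf : PMF ℤ) (N : ℕ)
    (num : L → ℤ) (A : Solver (Fin n) (ZMod q) m)
    (Acc : (Fin n → ZMod q) → Set (Fin NV → (Fin n → ZMod q) × ZMod (q * K)))
    (w : Fin ((Kg + 1) * J) → Fin (m + NV) → L) : PMF (Option (Fin n → ZMod q)) :=
  (indepLaw ((Kg + 1) * J) fun j =>
    (condBlockDataG bL q K m NV U (χc j) χf N num (w j)).bind (withAnswer q K m NV A)).map
    (firstAcceptedK q K m NV Acc)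

omit [InnerProductSpace ℝ E] [NeZero K] in
/-- **With the ideal laws, `condExpG` IS `condExpK`** (uniform shift, `floorGaussian (qN) (padNoise_j)`,
`floorGaussian (qKN) (α/√2)`). [folklore] -/
theorem condExpG_gaussian (α : ℝ) (N : ℕ) (num : L → ℤ) (A : Solver (Fin n) (ZMod q) m)
    (Acc : (Fin n → ZMod q) → Set (Fin NV → (Fin n → ZMod q) × ZMod (q * K)))
    (w : Fin ((Kg + 1) * J) → Fin (m + NV) → L) :
    condExpG bL q K m NV Kg J (PMF.uniformOfFintype (Fin n → ZMod q))
        (fun j => floorGaussian (q * N) (padNoise α Kg J j)) (floorGaussian (q * K * N) (α / Real.sqrt 2))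
        N num A Acc w =
      condExpK bL q K m NV Kg J α N num A Acc w := rfl

omit [InnerProductSpace ℝ E] [NeZero q] [NeZero K] in
/-- **Stability of one block's conditional data**: `Δ ≤ Δ(U, U') + m·Δ(χc, χc') + N_V·Δ(χf, χf')`
(hybrid over the shift, the `m` coarse and the `N_V` fine samples; the per-sample maps are data
processing). [cite: Goldreich2001, §3.2.3 (Thm 3.2.6, hybrid argument)] -/
theorem tvDist_condBlockDataG_le (U U' : PMF (Fin n → ZMod q)) (χc χc' χf χf' : PMF ℤ) (N : ℕ)
    (num : L → ℤ) (u : Fin (m + NV) → L) :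
    (condBlockDataG bL q K m NV U χc χf N num u).tvDist (condBlockDataG bL q K m NV U' χc' χf' N num u) ≤
      U.tvDist U' + m * χc.tvDist χc' + NV * χf.tvDist χf' := by
  unfold condBlockDataG
  refine (tvDist_prodLaw_le _ _ _ _).trans (add_le_add ((tvDist_prodLaw_le _ _ _ _).trans
    (add_le_add le_rfl ((tvDist_indepLaw_le m _ _).trans ?_))) ((tvDist_indepLaw_le NV _ _).trans ?_))
  · calc ∑ i : Fin m, (coarseKerG bL q χc N num (u (Fin.castAdd NV i))).tvDist
            (coarseKerG bL q χc' N num (u (Fin.castAdd NV i)))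
          ≤ ∑ _i : Fin m, χc.tvDist χc' := sum_le_sum fun i _ => PMF.tvDist_map_le_holds _ _ _
      _ = m * χc.tvDist χc' := by rw [sum_const, card_univ, Fintype.card_fin, nsmul_eq_mul]
  · calc ∑ i : Fin NV, (fineKerG bL q K χf N num (u (Fin.natAdd m i))).tvDist
            (fineKerG bL q K χf' N num (u (Fin.natAdd m i)))
          ≤ ∑ _i : Fin NV, χf.tvDist χf' := sum_le_sum fun i _ => PMF.tvDist_map_le_holds _ _ _
      _ = NV * χf.tvDist χf' := by rw [sum_const, card_univ, Fintype.card_fin, nsmul_eq_mul]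

omit [InnerProductSpace ℝ E] [NeZero q] [NeZero K] in
/-- **Stability of the whole conditional experiment** under perturbation of the three primitive laws,
for EVERY oracle kernel `A` and EVERY acceptance test:
`Δ(condExpG U χc χf …, condExpG U' χc' χf' …) ≤ Σ_j (Δ(U, U') + m·Δ(χc j, χc' j) + N_V·Δ(χf, χf'))`.
The oracle call is the SAME kernel on both sides (kernel contraction `tvDist_bind_left_le`), the blocks
are independent (hybrid `tvDist_indepLaw_le`), `firstAcceptedK` is data processing.
[cite: Goldreich2001, §3.2.3 (Thm 3.2.6, hybrid argument); RegevLWE2009, §3.2.1] -/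
theorem tvDist_condExpG_le (U U' : PMF (Fin n → ZMod q)) (χc χc' : Fin ((Kg + 1) * J) → PMF ℤ)
    (χf χf' : PMF ℤ) (N : ℕ) (num : L → ℤ) (A : Solver (Fin n) (ZMod q) m)
    (Acc : (Fin n → ZMod q) → Set (Fin NV → (Fin n → ZMod q) × ZMod (q * K)))
    (w : Fin ((Kg + 1) * J) → Fin (m + NV) → L) :
    (condExpG bL q K m NV Kg J U χc χf N num A Acc w).tvDist (condExpG bL q K m NV Kg J U' χc' χf' N num A Acc w) ≤
      ∑ j : Fin ((Kg + 1) * J), (U.tvDist U' + m * (χc j).tvDist (χc' j) + NV * χf.tvDist χf') := by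
  unfold condExpG
  refine (PMF.tvDist_map_le_holds _ _ _).trans ((tvDist_indepLaw_le _ _ _).trans (sum_le_sum fun j _ => ?_))
  exact (PMF.tvDist_bind_left_le _ _ _).trans (tvDist_condBlockDataG_le bL q K m NV U U' _ _ χf χf' N num (w j))

omit [InnerProductSpace ℝ E] [NeZero q] [NeZero K] in
/-- **Uniform version**: if `Δ(U, U') ≤ δ_U`, `Δ(χc j, χc' j) ≤ δ_c` for all `j` and `Δ(χf, χf') ≤ δ_f`, then
`Δ(condExpG …, condExpG' …) ≤ (K_g+1)J·(δ_U + m δ_c + N_V δ_f)`. [cite: Goldreich2001, §3.2.3] -/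
theorem tvDist_condExpG_le_of_le (U U' : PMF (Fin n → ZMod q)) (χc χc' : Fin ((Kg + 1) * J) → PMF ℤ)
    (χf χf' : PMF ℤ) (N : ℕ) (num : L → ℤ) (A : Solver (Fin n) (ZMod q) m)
    (Acc : (Fin n → ZMod q) → Set (Fin NV → (Fin n → ZMod q) × ZMod (q * K)))
    (w : Fin ((Kg + 1) * J) → Fin (m + NV) → L) {δU δc δf : ℝ} (hU : U.tvDist U' ≤ δU)
    (hc : ∀ j, (χc j).tvDist (χc' j) ≤ δc) (hf : χf.tvDist χf' ≤ δf) :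
    (condExpG bL q K m NV Kg J U χc χf N num A Acc w).tvDist (condExpG bL q K m NV Kg J U' χc' χf' N num A Acc w) ≤
      ((Kg + 1) * J : ℕ) * (δU + m * δc + NV * δf) := by
  refine (tvDist_condExpG_le bL q K m NV Kg J U U' χc χc' χf χf' N num A Acc w).trans ?_
  calc ∑ j : Fin ((Kg + 1) * J), (U.tvDist U' + m * (χc j).tvDist (χc' j) + NV * χf.tvDist χf')
        ≤ ∑ _j : Fin ((Kg + 1) * J), (δU + m * δc + NV * δf) :=
          sum_le_sum fun j _ => add_le_add (add_le_add hU
            (mul_le_mul_of_nonneg_left (hc j) (Nat.cast_nonneg _)))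
            (mul_le_mul_of_nonneg_left hf (Nat.cast_nonneg _))
    _ = ((Kg + 1) * J : ℕ) * (δU + m * δc + NV * δf) := by
          rw [sum_const, card_univ, Fintype.card_fin, nsmul_eq_mul]

omit [InnerProductSpace ℝ E] [NeZero K] in
/-- **Simulation up to the samplers' error.** If a law dominates event-wise, up to `ν`, the conditional
experiment run with APPROXIMATE primitive laws `U'`, `χc'`, `χf'` (the shape of the inequality in the
named fact A_cvpqM, for the machine's own sampler laws), and those laws are `δ_U`, `δ_c`, `δ_f`-close to
the uniform shift and the two integer Gaussians, then it dominates the IDEAL experiment `condExpK` up to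
`ν + (K_g+1)J(δ_U + m δ_c + N_V δ_f)`. This is the law-level half of a proof of A_cvpqM.
[cite: RegevLWE2009, §3.2.1 (Lemmas 3.7, 3.11 — "efficient algorithm"); Goldreich2001, §3.2.3] -/
theorem simulates_condExpK_of_condExpG (U' : PMF (Fin n → ZMod q)) (χc' : Fin ((Kg + 1) * J) → PMF ℤ)
    (χf' : PMF ℤ) (α : ℝ) (N : ℕ) (num : L → ℤ) (A : Solver (Fin n) (ZMod q) m)
    (Acc : (Fin n → ZMod q) → Set (Fin NV → (Fin n → ZMod q) × ZMod (q * K)))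
    (w : Fin ((Kg + 1) * J) → Fin (m + NV) → L) {δU δc δf : ℝ}
    (hU : U'.tvDist (PMF.uniformOfFintype (Fin n → ZMod q)) ≤ δU)
    (hc : ∀ j, (χc' j).tvDist (floorGaussian (q * N) (padNoise α Kg J j)) ≤ δc)
    (hf : χf'.tvDist (floorGaussian (q * K * N) (α / Real.sqrt 2)) ≤ δf)
    (S : Set (Option (Fin n → ZMod q))) {x ν : ℝ≥0∞}
    (hx : x ≤ (condExpG bL q K m NV Kg J U' χc' χf' N num A Acc w).toOuterMeasure S + ν) :
    x ≤ (condExpK bL q K m NV Kg J α N num A Acc w).toOuterMeasure S +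
      ENNReal.ofReal (((Kg + 1) * J : ℕ) * (δU + m * δc + NV * δf)) + ν := by
  have htv := tvDist_condExpG_le_of_le bL q K m NV Kg J U' (PMF.uniformOfFintype (Fin n → ZMod q)) χc'
    (fun j => floorGaussian (q * N) (padNoise α Kg J j)) χf' (floorGaussian (q * K * N) (α / Real.sqrt 2))
    N num A Acc w hU hc hf
  rw [← condExpG_gaussian]
  refine hx.trans (add_le_add ((PMF.toOuterMeasure_le_add_ofReal_tvDist _ _ S).trans
    (add_le_add le_rfl (ENNReal.ofReal_le_ofReal htv))) le_rfl)

end ConditionalG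

/-! ### The machine's shift sampler: coins read as integers modulo `q` -/

section Shift

variable (n q ℓ : ℕ) [NeZero q]

/-- LOCAL GLUE. **The coin-driven shift sampler's law**: `n` independent blocks of `ℓ` fair coins, each
read as an integer in `[0, 2^ℓ)` and reduced modulo `q`. [cite: RegevLWE2009, Lemma 4.1 (proof: "`t ∈ ℤ_pⁿ`
… uniformly")] -/
def shiftLawBits : PMF (Fin n → ZMod q) :=
  indepLaw n fun _ => (PMF.uniformOfFintype (Fin (2 ^ ℓ))).map fun x : Fin (2 ^ ℓ) => ((x : ℕ) : ZMod q)

/-- **The shift sampler is within `n·q/2^ℓ` of uniform on `ℤ_qⁿ`** (coordinatewise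
`tvDist_map_natMod_uniform_le`, then the hybrid bound `tvDist_indepLaw_uniformOfFintype_le`). With
`ℓ = size q + n` this is `≤ n/2ⁿ`. [cite: Goldreich2001, §3.2.3 (hybrid argument)] -/
theorem tvDist_shiftLawBits_le :
    (shiftLawBits n q ℓ).tvDist (PMF.uniformOfFintype (Fin n → ZMod q)) ≤ n * ((q : ℝ) / 2 ^ ℓ) := by
  refine (tvDist_indepLaw_uniformOfFintype_le n _).trans ?_
  calc ∑ _j : Fin n, ((PMF.uniformOfFintype (Fin (2 ^ ℓ))).map fun x : Fin (2 ^ ℓ) => ((x : ℕ) : ZMod q)).tvDist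
          (PMF.uniformOfFintype (ZMod q))
        ≤ ∑ _j : Fin n, ((q : ℝ) / 2 ^ ℓ) := sum_le_sum fun j _ => by
          simpa using tvDist_map_natMod_uniform_le (2 ^ ℓ) q
    _ = n * ((q : ℝ) / 2 ^ ℓ) := by rw [sum_const, card_univ, Fintype.card_fin, nsmul_eq_mul]

/-- **Precision `ℓ = size q + k` costs at most `n/2^k`** (`q < 2^{size q}`). [folklore] -/
theorem tvDist_shiftLawBits_size_add_le (k : ℕ) :
    (shiftLawBits n q (Nat.size q + k)).tvDist (PMF.uniformOfFintype (Fin n → ZMod q)) ≤ n / 2 ^ k := by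
  refine (tvDist_shiftLawBits_le n q _).trans ?_
  have hq : (q : ℝ) < 2 ^ Nat.size q := by exact_mod_cast Nat.lt_size_self q
  have h2k : (0 : ℝ) < 2 ^ k := by positivity
  have h2s : (0 : ℝ) < 2 ^ Nat.size q := by positivity
  rw [pow_add, div_eq_mul_inv, div_eq_mul_inv]
  refine mul_le_mul_of_nonneg_left ?_ (Nat.cast_nonneg _)
  rw [mul_inv, ← mul_assoc]
  refine mul_le_of_le_one_left (inv_nonneg.mpr h2k.le) ?_
  rw [mul_inv_le_iff₀ h2s, one_mul]
  exact hq.le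

end Shift

/-! ### The instance-level conditional experiment with the machine's sampler laws -/

namespace DigitOracle

open Peikert2009 Literature.Algebra.EuclideanLattices.LatticeInstance

/-- LOCAL GLUE. **The conditional experiment of an instance with primitive laws as parameters**:
`DigitOracle.condExp` (basis `zBasis I`, modulus `q`, fine factor `512`, the schedule, the integer
arithmetic `(N₀(t), num)`, the oracle kernel `A`, the rational test, the first `nVectors m n` batch
vectors in blocks) with the shift law `U`, the per-block coarse noise laws `χc` and the fine noise law `χf`
in place of the uniform law and the two integer Gaussians. A machine realises THIS law with its own
sampler laws. [cite: Regev2009, Lemma 3.4 (proof = §3.2.1: Lemmas 3.6, 3.7, 3.11, 4.1)] -/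
def condExpS (q : ℕ) [NeZero q] (m : ℕ) (α : ℝ) (I : LatticeInstance) (hI : I.IsNonsingular)
    (A : Solver (Fin I.n) (ZMod q) m) (t : Fin I.n → ℚ) {P : ℕ} (w : Fin P → I.lattice)
    (hP : nVectors m I.n ≤ P) (U : PMF (Fin I.n → ZMod q))
    (χc : Fin ((nLevels m + 1) * schedJ I.n) → PMF ℤ) (χf : PMF ℤ) : PMF (Option (Fin I.n → ZMod q)) :=
  haveI := I.isZLattice_of_isNonsingular hI
  condExpG (zBasis I) q schedK m (nVerify I.n) (nLevels m) (schedJ I.n) U χc χf (denom t) (numZ I t) A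
    (accTest q (nVerify I.n) α)
    (blocksOf ((nLevels m + 1) * schedJ I.n) (m + nVerify I.n) fun i => w (Fin.castLE hP i))

/-- **With the ideal laws `condExpS` IS `condExp`.** [folklore] -/
theorem condExpS_gaussian (q : ℕ) [NeZero q] (m : ℕ) (α : ℝ) (I : LatticeInstance) (hI : I.IsNonsingular)
    (A : Solver (Fin I.n) (ZMod q) m) (t : Fin I.n → ℚ) {P : ℕ} (w : Fin P → I.lattice)
    (hP : nVectors m I.n ≤ P) :
    condExpS q m α I hI A t w hP (PMF.uniformOfFintype (Fin I.n → ZMod q))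
        (fun j => floorGaussian (q * denom t) (padNoise α (nLevels m) (schedJ I.n) j))
        (floorGaussian (q * schedK * denom t) (α / Real.sqrt 2)) =
      condExp q m α I hI A t w hP := rfl

/-- **Simulation of an instance's conditional experiment up to the samplers' error**: if a law dominates
`condExpS` (run with sampler laws `U'`, `χc'`, `χf'`) event-wise up to `ν`, and the sampler laws are
`δ_U`, `δ_c`, `δ_f`-close to the uniform shift on `ℤ_qⁿ`, to `floorGaussian (q N₀(t)) (padNoise_j)` and
to `floorGaussian (512 q N₀(t)) (α/√2)`, then it dominates `condExp` up to
`ν + (K_g+1)(n+1)(δ_U + m δ_c + N_V(n) δ_f)` (`K_g = 24m+1`, `N_V(n) = 1600000(n+1)`).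
[cite: RegevLWE2009, §3.2.1 (Lemmas 3.7, 3.11: "efficient algorithm"); Goldreich2001, §3.2.3] -/
theorem simulates_condExp_of_condExpS (q : ℕ) [NeZero q] (m : ℕ) (α : ℝ) (I : LatticeInstance)
    (hI : I.IsNonsingular) (A : Solver (Fin I.n) (ZMod q) m) (t : Fin I.n → ℚ) {P : ℕ}
    (w : Fin P → I.lattice) (hP : nVectors m I.n ≤ P) (U' : PMF (Fin I.n → ZMod q))
    (χc' : Fin ((nLevels m + 1) * schedJ I.n) → PMF ℤ) (χf' : PMF ℤ) {δU δc δf : ℝ}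
    (hU : U'.tvDist (PMF.uniformOfFintype (Fin I.n → ZMod q)) ≤ δU)
    (hc : ∀ j, (χc' j).tvDist (floorGaussian (q * denom t) (padNoise α (nLevels m) (schedJ I.n) j)) ≤ δc)
    (hf : χf'.tvDist (floorGaussian (q * schedK * denom t) (α / Real.sqrt 2)) ≤ δf)
    (S : Set (Option (Fin I.n → ZMod q))) {x ν : ℝ≥0∞}
    (hx : x ≤ (condExpS q m α I hI A t w hP U' χc' χf').toOuterMeasure S + ν) :
    x ≤ (condExp q m α I hI A t w hP).toOuterMeasure S +
      ENNReal.ofReal (((nLevels m + 1) * schedJ I.n : ℕ) * (δU + m * δc + nVerify I.n * δf)) + ν := by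
  letI := I.isZLattice_of_isNonsingular hI
  have h := simulates_condExpK_of_condExpG (zBasis I) q schedK m (nVerify I.n) (nLevels m) (schedJ I.n)
    U' χc' χf' α (denom t) (numZ I t) A (accTest q (nVerify I.n) α)
    (blocksOf ((nLevels m + 1) * schedJ I.n) (m + nVerify I.n) fun i => w (Fin.castLE hP i)) hU hc hf S
    (x := x) (ν := ν)
  have e1 : condExpS q m α I hI A t w hP U' χc' χf' = condExpG (zBasis I) q schedK m (nVerify I.n)
      (nLevels m) (schedJ I.n) U' χc' χf' (denom t) (numZ I t) A (accTest q (nVerify I.n) α)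
      (blocksOf ((nLevels m + 1) * schedJ I.n) (m + nVerify I.n) fun i => w (Fin.castLE hP i)) := rfl
  have e2 : condExp q m α I hI A t w hP = condExpK (zBasis I) q schedK m (nVerify I.n)
      (nLevels m) (schedJ I.n) α (denom t) (numZ I t) A (accTest q (nVerify I.n) α)
      (blocksOf ((nLevels m + 1) * schedJ I.n) (m + nVerify I.n) fun i => w (Fin.castLE hP i)) := rfl
  rw [e1] at hx
  rw [e2]
  exact h hx

end DigitOracle

end Regev2009

end Literature.Computability.Cryptography
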